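import Summits.CriticalPhenomena.PercolationContinuityZ3.Theorems.Transplant.SqShadowTransport
import Literature.Probability.Percolation.SlabCriticalityInputs
import HarnessLib

/-!
# SQUARE SHADOWS III — the coarse lattice `c + 4n·ℤ²`, the good-edge configuration, its measurability, translation invariance and `5`-dependence
# (towards NODE B, the renormalisation step of Duminil-Copin–Sidoravicius–Tassion §2.2)

builds on p205010 (kernel theorem, internal audit signed; external expert review pending) — NOT used in this file.
Lane `prim-bschramm`, seat `prim-bschramm-p2` (gen 42; class C1b; memo `HOME/bschramm/P2-LATTICES.md` §148); helper file
(`--supports stmt-CriticalPhenomena-4575 --as helper`).  Interface `Transplant/SqShadowDefs`, tools `Transplant/SqShadowTransport`; hexagonal twin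
«HexShadowCoarse»; slab original `Literature/…/SlabCriticalityInputs` ll. 135–545 (`coarsePt`, `coarseConfig`, `measurable_coarseConfig`, `real_goodEvent_shift`,
`coarseRegion`, `determinedBy_preimage_coarseConfig`, `disjoint_coarseRegion`).

Coarse vertices `x ∈ ℤ²` sit at `c + 4n·x ∈ ℤ²` (`coarsePt`, DST's `4nℤ²` about the centre of symmetry); the GOOD-EDGE CONFIGURATION `coarseConfig n u ω ⊆ E(ℤ²)`
collects the coarse edges `{x, x+eᵢ}` whose good event `Ψ.goodEvent n u (c + 4n x) i` occurs; it is a measurable function of `ω`; every coarse edge is good with the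
probability of the centre edge of the same direction (`real_goodEvent_coarsePt`, `period ∣ n`), hence of the HORIZONTAL centre edge (`real_goodEvent_coarsePt_zero`, the
direction swap); coarse edges at sup-distance `≥ 5` depend on DISJOINT sets of edges of `G` (their regions `sqBall (· + 2n eᵢ) 6n` have centres `≥ 16n` apart in sup norm:
`disjoint_coarseRegion`).
[cite: DuminilCopinSidoraviciusTassion2016, §2.2 (arXiv p. 9)] [cite: GrimmettPercolation1999, §1.6 p. 16]
-/

noncomputable section

namespace Summit.CriticalPhenomena.PercolationContinuityZ3.Theorems.Transplant

open MeasureTheory Literature.Probability.Percolation Literature.Probability.LatticeModels SimpleGraph Filter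
open scoped Classical

namespace SqShadow

variable {V : Type} {G : SimpleGraph V} (Ψ : SqShadow G)

/-! ## §1 The coarse lattice `c + 4n·ℤ²` and the good-edge configuration -/

/-- The base point `c + 4n·x ∈ ℤ²` of the coarse vertex `x ∈ ℤ²`. [cite: DuminilCopinSidoraviciusTassion2016, §2.2] -/
def coarsePt (n : ℕ) (x : Site 2) : Site 2 := Ψ.centre + ((4 * n : ℕ) : ℤ) • x

/-- `coarsePt` of a coarse neighbour: `c + 4n(x + eᵢ) = (c + 4n x) + 4n eᵢ`. [folklore] -/
theorem coarsePt_add_single (n : ℕ) (x : Site 2) (i : Fin 2) :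
    Ψ.coarsePt n (x + Pi.single i 1) = Ψ.coarsePt n x + (4 * (n : ℤ)) • Pi.single i 1 := by
  simp only [coarsePt, smul_add]; push_cast; abel

/-- `coarsePt n 0 = c`. [folklore] -/
@[simp] theorem coarsePt_zero (n : ℕ) : Ψ.coarsePt n 0 = Ψ.centre := by simp [coarsePt]

/-- Coordinates of a coarse base point relative to the centre. [folklore] -/
theorem coarsePt_sub_centre_apply (n : ℕ) (x : Site 2) (j : Fin 2) : (Ψ.coarsePt n x - Ψ.centre) j = 4 * n * x j := by
  simp only [coarsePt, add_sub_cancel_left, Pi.smul_apply, smul_eq_mul]; push_cast; ring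

/-- **The good-edge configuration**: the nearest-neighbour edges `{x, x + eᵢ}` of the coarse lattice `ℤ²` whose good-edge event at `c + 4n x` occurs.
[cite: DuminilCopinSidoraviciusTassion2016, §2.2 ("Call an edge {z,z'} of 4nℤ² good if …")] -/
def coarseConfig (n u : ℕ) (ω : BondConfig V) : BondConfig (Site 2) :=
  {e | ∃ (x : Site 2) (i : Fin 2), e = s(x, x + Pi.single i 1) ∧ ω ∈ Ψ.goodEvent n u (Ψ.coarsePt n x) i}

/-- Membership of a coarse edge in the good-edge configuration. [cite: DuminilCopinSidoraviciusTassion2016, §2.2] -/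
theorem mk_mem_coarseConfig_iff (n u : ℕ) (ω : BondConfig V) (x : Site 2) (i : Fin 2) :
    s(x, x + Pi.single i 1) ∈ Ψ.coarseConfig n u ω ↔ ω ∈ Ψ.goodEvent n u (Ψ.coarsePt n x) i := by
  constructor
  · rintro ⟨x', j, he, hg⟩
    obtain ⟨rfl, rfl⟩ := (coarseEdge_eq_iff x x' i j).1 he
    exact hg
  · intro h
    exact ⟨x, i, rfl, h⟩

/-- The good-edge configuration is a measurable function of the configuration of `G`. [cite: DuminilCopinSidoraviciusTassion2016, §2.2] -/
theorem measurable_coarseConfig (n u : ℕ) : Measurable (Ψ.coarseConfig n u) := by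
  refine measurable_set_iff.2 fun e => ?_
  refine measurableSet_setOf.1 ?_
  have : {ω : BondConfig V | e ∈ Ψ.coarseConfig n u ω} =
      ⋃ x : Site 2, ⋃ i : Fin 2, {ω | e = s(x, x + Pi.single i 1) ∧ ω ∈ Ψ.goodEvent n u (Ψ.coarsePt n x) i} := by
    ext ω
    simp only [coarseConfig, Set.mem_setOf_eq, Set.mem_iUnion]
  rw [this]
  refine MeasurableSet.iUnion fun x => MeasurableSet.iUnion fun i => ?_
  by_cases he : e = s(x, x + Pi.single i 1)
  · simp only [he, true_and]
    exact Ψ.measurableSet_goodEvent n u _ i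
  · simp only [he, false_and, Set.setOf_false]
    exact MeasurableSet.empty

/-- **Every coarse edge of direction `i` is good with the probability of the centre edge of direction `i`** (`period ∣ n`).
[cite: DuminilCopinSidoraviciusTassion2016, §2.2 ("the probability to be good")] -/
theorem real_goodEvent_coarsePt [Countable V] (p : unitInterval) {n : ℕ} (hdvd : Ψ.period ∣ n) (u : ℕ) (x : Site 2) (i : Fin 2) :
    (bondPercolation G p).real (Ψ.goodEvent n u (Ψ.coarsePt n x) i) = (bondPercolation G p).real (Ψ.goodEvent n u Ψ.centre i) := by
  obtain ⟨m, hm⟩ := hdvd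
  have e : Ψ.coarsePt n x = Ψ.centre + (Ψ.period : ℤ) • ((4 * (m : ℤ)) • x) := by
    simp only [coarsePt, hm, smul_smul]; push_cast; ring_nf
  rw [e, Ψ.real_goodEvent_shift]

/-- **Every coarse edge is good with the probability of the HORIZONTAL centre edge** (`period ∣ n`; translation invariance and the direction swap).
[cite: DuminilCopinSidoraviciusTassion2016, §2.2 ("the probability to be good")] -/
theorem real_goodEvent_coarsePt_zero [Countable V] (p : unitInterval) {n : ℕ} (hdvd : Ψ.period ∣ n) (u : ℕ) (x : Site 2) (i : Fin 2) :
    (bondPercolation G p).real (Ψ.goodEvent n u (Ψ.coarsePt n x) i) = (bondPercolation G p).real (Ψ.goodEvent n u Ψ.centre 0) := by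
  rw [Ψ.real_goodEvent_coarsePt p hdvd]
  fin_cases i
  · rfl
  · exact Ψ.real_goodEvent_one_eq p n u

/-! ## §2 `5`-dependence: far coarse edges depend on disjoint sets of edges of `G` -/

/-- The edges of `G` on which the state of the coarse edge `e` depends: for `e = {x, x + eᵢ}`, the edges over the region `sqBall (c + 4n x + 2n eᵢ) 6n` (none for other
pairs). [cite: DuminilCopinSidoraviciusTassion2016, §2.2] -/
def coarseRegion (n : ℕ) (e : Sym2 (Site 2)) : Set (Sym2 V) :=
  {d | ∃ (x : Site 2) (i : Fin 2), e = s(x, x + Pi.single i 1) ∧ d ∈ Set.sym2 (Ψ.lift (sqBall (Ψ.coarsePt n x + (2 * (n : ℤ)) • Pi.single i 1) (6 * n)))}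

/-- Events of the coarse configuration determined by the coarse edges in `F` pull back to events determined by the edges of `G` in `⋃_{e ∈ F} coarseRegion e`.
[cite: DuminilCopinSidoraviciusTassion2016, §2.2 ("being good depends only on the state of the edges in a finite box")] -/
theorem determinedBy_preimage_coarseConfig (n u : ℕ) {A : Set (BondConfig (Site 2))} {F : Finset (Sym2 (Site 2))}
    (hA : DeterminedBy A (↑F : Set (Sym2 (Site 2)))) : DeterminedBy (Ψ.coarseConfig n u ⁻¹' A) (⋃ e ∈ F, Ψ.coarseRegion n e) := by
  rw [determinedBy_iff] at hA ⊢
  intro ω ω' h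
  have key : ∀ e ∈ F, (e ∈ Ψ.coarseConfig n u ω ↔ e ∈ Ψ.coarseConfig n u ω') := by
    intro e he
    simp only [coarseConfig, Set.mem_setOf_eq]
    refine exists_congr fun x => exists_congr fun i => and_congr_right fun hex => ?_
    refine (determinedBy_iff _ _).1 (Ψ.determinedBy_goodEvent n u (Ψ.coarsePt n x) i) ω ω' ?_
    set R := Set.sym2 (Ψ.lift (sqBall (Ψ.coarsePt n x + (2 * (n : ℤ)) • Pi.single i 1) (6 * n))) with hR
    have hsub : R ⊆ ⋃ e ∈ F, Ψ.coarseRegion n e := fun d hd => Set.mem_biUnion (Finset.mem_coe.2 he) ⟨x, i, hex, hd⟩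
    calc ω ∩ R = (ω ∩ ⋃ e ∈ F, Ψ.coarseRegion n e) ∩ R := by rw [Set.inter_assoc, Set.inter_eq_right.2 hsub]
      _ = (ω' ∩ ⋃ e ∈ F, Ψ.coarseRegion n e) ∩ R := by rw [h]
      _ = ω' ∩ R := by rw [Set.inter_assoc, Set.inter_eq_right.2 hsub]
  simp only [Set.mem_preimage]
  apply hA
  ext e
  simp only [Set.mem_inter_iff, Finset.mem_coe]
  constructor
  · rintro ⟨h1, h2⟩; exact ⟨(key e h2).1 h1, h2⟩
  · rintro ⟨h1, h2⟩; exact ⟨(key e h2).2 h1, h2⟩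

/-- **`5`-dependence** (`n ≥ 1`): coarse edges whose vertices are at sup-distance `≥ 5` depend on disjoint sets of edges of `G` (their regions have sup-radius `6n` about
centres `≥ 4n·5 − 4n = 16n` apart in sup norm). [cite: DuminilCopinSidoraviciusTassion2016, §2.2 ("4-dependent")] -/
theorem disjoint_coarseRegion {n : ℕ} (hn : 1 ≤ n) {F₁ F₂ : Finset (Sym2 (Site 2))}
    (hfar : ∀ e₁ ∈ F₁, ∀ e₂ ∈ F₂, ∀ a ∈ e₁, ∀ b ∈ e₂, (5 : ℤ) ≤ max |a 0 - b 0| |a 1 - b 1|) :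
    Disjoint (⋃ e ∈ F₁, Ψ.coarseRegion n e) (⋃ e ∈ F₂, Ψ.coarseRegion n e) := by
  rw [Set.disjoint_left]
  intro d hd1 hd2
  simp only [Set.mem_iUnion, coarseRegion, Set.mem_setOf_eq, exists_prop] at hd1 hd2
  obtain ⟨e₁, he₁, x₁, i₁, hex₁, hd₁⟩ := hd1
  obtain ⟨e₂, he₂, x₂, i₂, hex₂, hd₂⟩ := hd2
  have h5 := hfar e₁ he₁ e₂ he₂ x₁ (by rw [hex₁]; exact Sym2.mem_mk_left _ _) x₂ (by rw [hex₂]; exact Sym2.mem_mk_left _ _)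
  obtain ⟨v, hv⟩ : ∃ v, v ∈ d := ⟨d.out.1, Sym2.out_fst_mem d⟩
  have hv₁ := Set.mem_sym2_iff_subset.1 hd₁ hv
  have hv₂ := Set.mem_sym2_iff_subset.1 hd₂ hv
  rw [mem_lift, mem_sqBall_iff_linear] at hv₁ hv₂
  simp only [Pi.add_apply, smul_single_apply] at hv₁ hv₂
  have c₁0 := Ψ.coarsePt_sub_centre_apply n x₁ 0
  have c₁1 := Ψ.coarsePt_sub_centre_apply n x₁ 1
  have c₂0 := Ψ.coarsePt_sub_centre_apply n x₂ 0
  have c₂1 := Ψ.coarsePt_sub_centre_apply n x₂ 1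
  simp only [Pi.sub_apply] at c₁0 c₁1 c₂0 c₂1
  have hn' : (1 : ℤ) ≤ n := by exact_mod_cast hn
  -- the coarse coordinates differ by at least `5` in one direction, so the region centres differ by at least `16n` there
  rw [le_max_iff, le_abs, le_abs] at h5
  rcases h5 with (h | h) | (h | h)
  · have hm : 4 * (n : ℤ) * 5 ≤ 4 * n * (x₁ 0 - x₂ 0) := mul_le_mul_of_nonneg_left h (by positivity)
    fin_cases i₁ <;> fin_cases i₂ <;> simp at hv₁ hv₂ <;> nlinarith
  · have hm : 4 * (n : ℤ) * 5 ≤ 4 * n * (x₂ 0 - x₁ 0) := mul_le_mul_of_nonneg_left (by linarith) (by positivity)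
    fin_cases i₁ <;> fin_cases i₂ <;> simp at hv₁ hv₂ <;> nlinarith
  · have hm : 4 * (n : ℤ) * 5 ≤ 4 * n * (x₁ 1 - x₂ 1) := mul_le_mul_of_nonneg_left h (by positivity)
    fin_cases i₁ <;> fin_cases i₂ <;> simp at hv₁ hv₂ <;> nlinarith
  · have hm : 4 * (n : ℤ) * 5 ≤ 4 * n * (x₂ 1 - x₁ 1) := mul_le_mul_of_nonneg_left (by linarith) (by positivity)
    fin_cases i₁ <;> fin_cases i₂ <;> simp at hv₁ hv₂ <;> nlinarith

/-! ## §3 Geometry of the blocks along a coarse path -/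

/-- Off the origin, the coarse base point is at sup-distance `≥ 4n` from the centre. [folklore] -/
theorem coarsePt_far {n : ℕ} {x : Site 2} (hx : x ≠ 0) :
    4 * (n : ℤ) ≤ |(Ψ.coarsePt n x - Ψ.centre) 0| ∨ 4 * (n : ℤ) ≤ |(Ψ.coarsePt n x - Ψ.centre) 1| := by
  have h : x 0 ≠ 0 ∨ x 1 ≠ 0 := by
    by_contra h
    push Not at h
    apply hx
    funext j
    fin_cases j
    · exact h.1
    · exact h.2
  rw [Ψ.coarsePt_sub_centre_apply, Ψ.coarsePt_sub_centre_apply, abs_mul (4 * (n : ℤ)) (x 0), abs_mul (4 * (n : ℤ)) (x 1),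
    abs_of_nonneg (show (0 : ℤ) ≤ 4 * (n : ℤ) by positivity)]
  rcases h with h | h
  · exact Or.inl (le_mul_of_one_le_right (by positivity) (Int.one_le_abs h))
  · exact Or.inr (le_mul_of_one_le_right (by positivity) (Int.one_le_abs h))

/-- A block `S = sqBall (z + 4n eᵢ) u` neighbouring the block at `z` (`u ≤ n`) meets `sqBall z 3n` only on its boundary, and symmetrically. [folklore] -/
theorem sqBall_shift_inter_subset_sqRing {n u : ℕ} (hu : u ≤ n) (z : Site 2) (i : Fin 2) :
    sqBall (z + (4 * (n : ℤ)) • Pi.single i 1) u ∩ sqBall z (3 * n) ⊆ sqRing z (3 * n) ∧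
      sqBall z u ∩ sqBall (z + (4 * (n : ℤ)) • Pi.single i 1) (3 * n) ⊆ sqRing (z + (4 * (n : ℤ)) • Pi.single i 1) (3 * n) := by
  have hu' : (u : ℤ) ≤ n := by exact_mod_cast hu
  constructor
  · rintro w ⟨hw1, hw2⟩
    rw [mem_sqRing_iff_linear]
    refine ⟨hw2, ?_⟩
    rw [mem_sqBall_iff_linear] at hw1 hw2
    simp only [Pi.add_apply, smul_single_apply] at hw1
    fin_cases i <;> simp at hw1 ⊢ <;> omega
  · rintro w ⟨hw1, hw2⟩
    rw [mem_sqRing_iff_linear]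
    refine ⟨hw2, ?_⟩
    rw [mem_sqBall_iff_linear] at hw1 hw2
    simp only [Pi.add_apply, smul_single_apply] at hw2 ⊢
    fin_cases i <;> simp at hw2 ⊢ <;> omega

/-- The centre block `sqBall c u` meets a block `sqBall (coarsePt n x) 3n` centred at a coarse point `x ≠ 0` only on its boundary (`u ≤ n`). [folklore] -/
theorem sqBall_centre_inter_subset_sqRing {n u : ℕ} (hu : u ≤ n) {x : Site 2} (hx : x ≠ 0) :
    sqBall Ψ.centre u ∩ sqBall (Ψ.coarsePt n x) (3 * n) ⊆ sqRing (Ψ.coarsePt n x) (3 * n) := by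
  rintro w ⟨hw1, hw2⟩
  rw [mem_sqRing_iff_linear]
  refine ⟨hw2, ?_⟩
  have hfar := Ψ.coarsePt_far (n := n) hx
  simp only [Pi.sub_apply] at hfar
  rw [le_abs, le_abs] at hfar
  rw [mem_sqBall_iff_linear] at hw1 hw2
  have hu' : (u : ℤ) ≤ n := by exact_mod_cast hu
  omega

end SqShadow

end Summit.CriticalPhenomena.PercolationContinuityZ3.Theorems.Transplant

end
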